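import Literature.MathematicalPhysics.QuantumFieldTheory.Balaban1983to89.Beta.RootedComb
import Literature.MathematicalPhysics.QuantumFieldTheory.Balaban1983to89.Beta.TransportedContourVariables

/-!
# The base-rooted comb is not reflection-covariant: a located negative instance (`d = 2`, `L = 2`)

HONEST FRAMING (cell rule, verbatim): discharging `BetaPertH` makes Bałaban's UV stability UNCONDITIONAL — a real
constructive-QFT result; it is NOT the continuum limit and NOT the Clay problem.  This file discharges nothing: it is a
LOCATED NEGATIVE INSTANCE, kernel-checked by finite evaluation (`decide`) and casts; every declaration is [folklore];
nothing is cited, no `Prop` is minted.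

## What it proves

The typed BASE-ROOTED linear averaging `AveragingContours.linAvg` (one axial comb contour per fine site, rooted at the
block base corner `L•y`) and the base-rooted axial projector `AxialProjector.axProj` are NOT covariant under EITHER
block-compatible axis reflection `ResolventReflection.sref α : x_α ↦ −1 − x_α` (pull-back `R1 α`), already for `d = 2`,
`L = 2`, with the test form `A0` = the indicator of ONE fine bond (a tree bond of the base-rooted comb of the block
`{0,1}²`):

* §1 eight values of `linAvg A0 2` (unnormalised): `(μ,y) = (0,(0,0)) ↦ 2`, `(0,(−1,0)) ↦ −2`, `(1,(0,0)) ↦ 3`,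
  `(1,(0,−1)) ↦ −1`, zero at `(0,(0,−1))`, `(0,(−1,−1))`, `(1,(0,−2))`, `(1,(−1,0))`;
* §2 axis `α = 1`: LHS `linAvg (R1 1 A0) 2` vs RHS `R1 1 (linAvg A0 2)` at four coarse bonds — `2/−2`, `−2/2`, `1/−3`,
  `−3/1` (`axis1_values`), hence `linAvg_not_covariant_axis1_int`;
* §3 axis `α = 0`: `0/2`, `0/−2`, `1/3`, `1/−1` (`axis0_values`), hence `linAvg_not_covariant_axis0_int`;
* §4 the same over `ℝ` with the tree's own `R1` (`R1_mapForm`, `linAvg_mapForm`):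
  **`linAvg_not_reflectionCovariant_axis1/axis0 : linAvg (R1 α A0R) 2 ≠ R1 α (linAvg A0R 2)`** and, because
  `linAvg = contourSum ∘ axProj` (`AxialProjector.linAvg_eq_contourSum_axProj`) with `contourSum` covariant
  (`ResolventReflection.contourSum_R1`), **`axProj_not_reflectionCovariant (α : Fin 2) :
  axProj 2 (R1 α A0R) ≠ R1 α (axProj 2 A0R)`**;
* §5 CONTRAST: with Bałaban's CENTRED root (`AveragingContoursRooted.ctr`, odd `L = 3`) the rooted averaging and the rooted
  projector ARE covariant for every form and both axes (`RootedComb.linAvgAt_R1` / `axProjAt_R1`, instantiated).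

The mechanism (orientation, not a hypothesis): `sref α` carries the block of `y` to the block of `bref α α y` but the
base CORNER to the α-TOP corner (`RootedComb.sref_base_ne_base`), so the reflected comb is a different tree / differently
rooted; only the centre of an odd block is fixed by all axis reflections (`RootedComb.sref_root_ctr`,
`two_mul_add_one_eq_of_sref_root`).  In print the blocks are centred and `L` is odd ([Balaban1987RG1] CMP 109 p.251,
p.252 (0.3) — orientation only).

VERSION v1 (2026-08-19, b2b-balaban-beta-an5-g17): new leaf (the kernel certificate of journal NOTE X-an5-17 (F2),
previously a seat record); imports `…Beta.RootedComb` and `…Beta.TransportedContourVariables` BY NAME; nothing modified.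
-/

namespace Literature.MathematicalPhysics.QuantumFieldTheory.Balaban1983to89.Beta.CornerRootInstance

open AffineAveraging (Form1 contourSum)
open AveragingContours (linAvg)
open AxialProjector (axProj linAvg_eq_contourSum_axProj)
open TransportedContourVariables (mapForm gammaC_map)
open PolarizationSign (reflSign)
open ResolventReflection (sref bref R1 R1_apply contourSum_R1)
open AveragingContoursRooted (linAvgAt ctr)

/-- [folklore] Integer pull-back of a 1-form under the axis-`α` reflection: the formula of `ResolventReflection.R1`
(`reflSign α κ * A κ (bref α κ x)`, `reflSign α κ = if κ = α then −1 else 1`) written over `ℤ`. -/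
def R1Z (α : Fin 2) (A : Form1 2 ℤ) : Form1 2 ℤ := fun κ x => if κ = α then -A κ (bref α κ x) else A κ (bref α κ x)

/-- [folklore] Test form: the indicator of the fine bond `(κ = 1, x = (0,0))` (from `(0,0)` to `(0,1)`; a TREE bond of the base-rooted
comb of the block `B(0,0) = {0,1}²`, comb order: axis 1 first). -/
def A0 : Form1 2 ℤ := fun κ x => if κ = 1 ∧ x 0 = 0 ∧ x 1 = 0 then 1 else 0

/-! ## 1. The values of `linAvg A0 2` (unnormalised (14); hand formula: at `(μ = 0, y)` it is
`2·[Σ of A₀ over the four horizontal bonds based in B(y)]/2 … ` — here simply evaluated by the kernel) -/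

/-- [folklore] Eight values of the base-rooted `linAvg A0 2` (unnormalised (14)), by kernel evaluation. -/
theorem linAvg_A0_values :
    linAvg A0 2 0 ![0, 0] = 2 ∧ linAvg A0 2 0 ![-1, 0] = -2 ∧ linAvg A0 2 1 ![0, 0] = 3 ∧ linAvg A0 2 1 ![0, -1] = -1 ∧
    linAvg A0 2 0 ![0, -1] = 0 ∧ linAvg A0 2 0 ![-1, -1] = 0 ∧ linAvg A0 2 1 ![0, -2] = 0 ∧ linAvg A0 2 1 ![-1, 0] = 0 := by
  decide

/-! ## 2. Axis `α = 1` (the comb's FIRST-traversed axis: the tree is preserved, the ROOT moves to the top face) -/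

/-- [folklore] The reflected test form is (minus) the indicator of the bond `(1, (0,−2))`. -/
theorem R1Z_one_A0 : R1Z 1 A0 1 ![0, -2] = -1 ∧ R1Z 1 A0 1 ![0, 0] = 0 := by decide

/-- [folklore] LHS vs RHS of the would-be covariance law at four coarse bonds (axis `α = 1`): every one differs (signs flip on `μ = 0`,
magnitudes swap on `μ = 1`). -/
theorem axis1_values :
    linAvg (R1Z 1 A0) 2 0 ![-1, -1] = 2 ∧ R1Z 1 (linAvg A0 2) 0 ![-1, -1] = -2 ∧
    linAvg (R1Z 1 A0) 2 0 ![0, -1] = -2 ∧ R1Z 1 (linAvg A0 2) 0 ![0, -1] = 2 ∧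
    linAvg (R1Z 1 A0) 2 1 ![0, -2] = 1 ∧ R1Z 1 (linAvg A0 2) 1 ![0, -2] = -3 ∧
    linAvg (R1Z 1 A0) 2 1 ![0, -1] = -3 ∧ R1Z 1 (linAvg A0 2) 1 ![0, -1] = 1 := by
  decide

/-- [folklore] Over `ℤ`: the base-rooted `linAvg` is NOT covariant under the axis-1 reflection (`d = 2`, `L = 2`). -/
theorem linAvg_not_covariant_axis1_int : linAvg (R1Z 1 A0) 2 ≠ R1Z 1 (linAvg A0 2) := by
  intro h
  have := congrFun (congrFun h 0) ![0, -1]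
  rw [axis1_values.2.2.1, axis1_values.2.2.2.1] at this
  exact absurd this (by decide)

/-! ## 3. Axis `α = 0` (the comb tree itself changes: the image bond sits on a RIGHT edge, off the tree) -/

/-- [folklore] The axis-0 reflected test form is the indicator of the bond `(1, (−1,0))`. -/
theorem R1Z_zero_A0 : R1Z 0 A0 1 ![-1, 0] = 1 ∧ R1Z 0 A0 1 ![-2, 0] = 0 := by decide

/-- [folklore] LHS vs RHS of the would-be covariance law at four coarse bonds (axis `α = 0`): every one differs. -/
theorem axis0_values :
    linAvg (R1Z 0 A0) 2 0 ![-1, 0] = 0 ∧ R1Z 0 (linAvg A0 2) 0 ![-1, 0] = 2 ∧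
    linAvg (R1Z 0 A0) 2 0 ![-2, 0] = 0 ∧ R1Z 0 (linAvg A0 2) 0 ![-2, 0] = -2 ∧
    linAvg (R1Z 0 A0) 2 1 ![-1, 0] = 1 ∧ R1Z 0 (linAvg A0 2) 1 ![-1, 0] = 3 ∧
    linAvg (R1Z 0 A0) 2 1 ![-1, -1] = 1 ∧ R1Z 0 (linAvg A0 2) 1 ![-1, -1] = -1 := by
  decide

/-- [folklore] Over `ℤ`: the base-rooted `linAvg` is NOT covariant under the axis-0 reflection (`d = 2`, `L = 2`). -/
theorem linAvg_not_covariant_axis0_int : linAvg (R1Z 0 A0) 2 ≠ R1Z 0 (linAvg A0 2) := by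
  intro h
  have := congrFun (congrFun h 0) ![-1, 0]
  rw [axis0_values.1, axis0_values.2.1] at this
  exact absurd this (by decide)

/-! ## 4. The same over `ℝ` with the tree's OWN `ResolventReflection.R1` (so the instance speaks about the literal (Sr)-type
law `X (R1 α A) = R1 α (X A)`), and the consequence for an2's `axProj` -/

/-- [folklore] The real test form (cast of `A0`). -/
noncomputable def A0R : Form1 2 ℝ := mapForm (Int.castAddHom ℝ) A0

/-- [folklore] `R1` of a cast form is the cast of `R1Z`. -/
theorem R1_mapForm (α : Fin 2) (A : Form1 2 ℤ) :
    R1 α (mapForm (Int.castAddHom ℝ) A) = mapForm (Int.castAddHom ℝ) (R1Z α A) := by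
  funext κ x
  simp only [R1_apply, mapForm, R1Z, reflSign, Int.coe_castAddHom]
  split_ifs <;> push_cast <;> ring

/-- [folklore] `linAvg` is natural in the coefficients. -/
theorem linAvg_mapForm (A : Form1 2 ℤ) (L : ℕ) (μ : Fin 2) (y : Fin 2 → ℤ) :
    linAvg (mapForm (Int.castAddHom ℝ) A) L μ y = ((linAvg A L μ y : ℤ) : ℝ) := by
  simp only [linAvg, ← gammaC_map, ← Int.coe_castAddHom, map_sum, map_list_sum]

/-- [folklore] **`linAvg` IS NOT COVARIANT UNDER THE REFLECTION OF AXIS 1** (the tree-preserving axis). -/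
theorem linAvg_not_reflectionCovariant_axis1 : linAvg (R1 1 A0R) 2 ≠ R1 1 (linAvg A0R 2) := by
  intro h
  have h1 := congrFun (congrFun h 0) ![0, -1]
  rw [A0R, R1_mapForm, linAvg_mapForm, R1_apply, linAvg_mapForm, axis1_values.2.2.1] at h1
  have hb : bref (1 : Fin 2) 0 ![0, -1] = ![0, 0] := by decide
  rw [hb, linAvg_A0_values.1] at h1
  norm_num [reflSign] at h1

/-- [folklore] **`linAvg` IS NOT COVARIANT UNDER THE REFLECTION OF AXIS 0.** -/
theorem linAvg_not_reflectionCovariant_axis0 : linAvg (R1 0 A0R) 2 ≠ R1 0 (linAvg A0R 2) := by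
  intro h
  have h1 := congrFun (congrFun h 0) ![-1, 0]
  rw [A0R, R1_mapForm, linAvg_mapForm, R1_apply, linAvg_mapForm, axis0_values.1] at h1
  have hb : bref (0 : Fin 2) 0 ![-1, 0] = ![-1, 0] := by decide
  rw [hb, linAvg_A0_values.2.1] at h1
  norm_num [reflSign] at h1

/-- [folklore] **THE BASE-ROOTED AXIAL PROJECTOR IS NOT REFLECTION-COVARIANT, EITHER AXIS**: since `linAvg = contourSum ∘ axProj`
(`AxialProjector.linAvg_eq_contourSum_axProj`) and `contourSum` IS covariant (`ResolventReflection.contourSum_R1`). -/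
theorem axProj_not_reflectionCovariant (α : Fin 2) : axProj 2 (R1 α A0R) ≠ R1 α (axProj 2 A0R) := by
  intro h
  have key : linAvg (R1 α A0R) 2 = R1 α (linAvg A0R 2) := by
    funext μ y
    rw [linAvg_eq_contourSum_axProj (by norm_num) (R1 α A0R) μ y, h, contourSum_R1]
    congr 1
    funext μ' y'
    rw [linAvg_eq_contourSum_axProj (by norm_num)]
  fin_cases α
  · exact linAvg_not_reflectionCovariant_axis0 key
  · exact linAvg_not_reflectionCovariant_axis1 key

/-! ## 5. Contrast: at the CENTRE root the same objects ARE covariant (odd `L`; `RootedComb`) -/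

/-- [folklore] CONTRAST (instance of `RootedComb.linAvgAt_R1`): in the same toy dimension `d = 2`, with the odd blocking
factor `L = 3` and Bałaban's CENTRED root `ctr 2 3 = (1,1)`, the rooted linear averaging IS covariant under both axis
reflections, for EVERY form. -/
theorem linAvgAt_ctr_reflectionCovariant (α : Fin 2) (A : Form1 2 ℝ) :
    linAvgAt (ctr 2 3) (R1 α A) 3 = R1 α (linAvgAt (ctr 2 3) A 3) :=
  RootedComb.linAvgAt_R1 (by decide) α A

/-- [folklore] CONTRAST (instance of `RootedComb.axProjAt_R1`): the CENTRED axial projector is covariant (`d = 2`, `L = 3`). -/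
theorem axProjAt_ctr_reflectionCovariant (α : Fin 2) (A : Form1 2 ℝ) :
    RootedComb.axProjAt (ctr 2 3) 3 (R1 α A) = R1 α (RootedComb.axProjAt (ctr 2 3) 3 A) :=
  RootedComb.axProjAt_R1 (by decide) α A

end Literature.MathematicalPhysics.QuantumFieldTheory.Balaban1983to89.Beta.CornerRootInstance
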